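/-
Copyright (c) 2026 the pub-hodgecm-mathlib formalisation cell (harness21).  Prover seat hodgecm-mathlib-A-p03 (g24); LEAD F0P3a-plan (g9) WORD T8-41 «(F4)–(F8) PEN 1»;
LAYER C, θ̄ = 1, Cor. 9 discharged by B-p04 (g33)'s `UnitaryThreeFixedPointsCountTheta`, 2026-09-01.
-/
import Literature.NumberTheory.Rogawski1990.UnitOrbitalIntegralInertValueThetaOne
import Literature.NumberTheory.Automorphic.UnitaryThreeFixedPointsCountTheta            -- ★ B-p04 (F3c-C9-θ)
import HarnessLib

/-!
# LAYER C, `θ̄ = 1`, closed form: `#{q ∈ U⧸K : t_π q = q} = phiOne q N₊ N` with Cor. 9 supplied by ★ `natCard_fixedPoints_flickerTorus_eq_finsum`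

Topic `NumberTheory/Rogawski1990` (road «D-N7-inert», MAP v3 LAYER C); namespace `Literature.NumberTheory.Automorphic.UnitaryGroup`.  THEOREMS ONLY; kernel lane.

★ `natCard_fixedPoints_unitaryInt_flickerTorus_eq_phiOne` (p841645) took Cor. 9 at the θ-torus as the hypothesis `hC9` (in the (F2) quotient currency
`((unitaryInt).map (MulAut.conj u_m)).subgroupOf H`); B-p04's ★ `natCard_fixedPoints_flickerTorus_eq_finsum` proves it in the `(flickerHK c u_m).subgroupOf H`
currency over the (F3c-γ) lattice bridge `(R, ι, σR, dR, ϖR)`.  Since `flickerHK c u = H ⊓ (unitaryInt).map (conj u)` the two `subgroupOf H` coincide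
(`subgroupOf_flickerHK_eq`), and this file discharges `hC9`: **`natCard_fixedPoints_unitaryInt_flickerTorus_eq_phiOne_of_bridge`** — the θ̄ = 1 VALUE
`#Fix_{U⧸K}(t_ϖ(a,b,c)) = phiOne q N₊ N` with only frame∕bridge data as hypotheses.
HONEST LABEL: HC_CM is proved only modulo the printed citations until rung 0 closes.

## References
* [Flicker1998UnitaryFL] Y. Z. Flicker, *Elementary proof of the fundamental lemma for a unitary group*, Canad. J. Math. 50 (1998), 74–98: Prop. 5 p. 82, Cor. 9 p. 85,
  Prop. 10 pp. 85–86, Prop. 11 p. 87.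
* [Rogawski1990] J. D. Rogawski, *Automorphic Representations of Unitary Groups in Three Variables* (1990), §4.9 p. 55.
-/

set_option autoImplicit false

open scoped MatrixGroups WithZero Valued
open Matrix

universe u

namespace Literature.NumberTheory.Automorphic

namespace UnitaryGroup

open Literature.NumberTheory.Automorphic.HermitianLattice (unitaryInt mem_unitaryInt_iff LocalConjDatum)
open Literature.NumberTheory.Rogawski1990.Flicker1998 (iTen phiOne corNineWeight)
open IsLocalRing

variable {K : Type*} [Field K] [Valued K ℤᵐ⁰] {ϖ : K} (σ : K →+* K) {J : Matrix (Fin 3) (Fin 3) K}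

omit [Valued K ℤᵐ⁰] in
/-- `H^K_u ∩ H` seen inside `H`: `(flickerHK c u).subgroupOf H = ((unitaryInt).map (conj u)).subgroupOf H` (`flickerHK c u = H ⊓ …`).
[cite: Flicker1998UnitaryFL, Prop. 5 p. 82] -/
theorem subgroupOf_flickerHK_eq [Valued K ℤᵐ⁰] (c u : ↥(unitaryGroupOfForm σ J)) :
    (flickerHK σ J c u).subgroupOf (Subgroup.centralizer ({c} : Set ↥(unitaryGroupOfForm σ J))) =
      ((unitaryInt σ J).map (MulAut.conj u).toMonoidHom).subgroupOf (Subgroup.centralizer ({c} : Set ↥(unitaryGroupOfForm σ J))) := by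
  rw [flickerHK]; exact Subgroup.inf_subgroupOf_left _ _

section ThetaOneClosed

variable [IsDiscreteValuationRing 𝒪[K]] [Finite (ResidueField 𝒪[K])] [IsAdicComplete (maximalIdeal 𝒪[K]) 𝒪[K]]

set_option synthInstance.maxHeartbeats 200000 in
-- the `H`-action on `H ⧸ (K^{u_m} ∩ H)` is found through the large subgroup terms of the `U(2,1)` frame (as in ★ (F2))
/-- **LAYER C, `θ̄ = 1`, CLOSED**: for `t = t_ϖ(a,b,c)` (F0P3-p02's literal, `θ = ϖ`), `#{q ∈ U⧸K : t q = q} = phiOne q N₊ N`, the Cor. 9 input supplied by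
★ B-p04's `natCard_fixedPoints_flickerTorus_eq_finsum` over the (F3c-γ) lattice bridge `(R, ι, σR, dR, ϖR)` (`#k_R = q²`).
[cite: Flicker1998UnitaryFL, Prop. 5 p. 82, Cor. 9 p. 85, Prop. 10 pp. 85–86, Prop. 11 p. 87] -/
theorem natCard_fixedPoints_unitaryInt_flickerTorus_eq_phiOne_of_bridge (hJ : J = (StdForm.antidiagonal 3).over K) (hd : LocalConjDatum σ ϖ)
    (hσO : ∀ y : 𝒪[K], (σ.comp 𝒪[K].subtype) y ∈ 𝒪[K]) {y : K} (hy : y * σ y = -2)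
    {c : ↥(unitaryGroupOfForm σ J)} (hc : ((c : GL (Fin 3) K) : Matrix (Fin 3) (Fin 3) K) = !![1, 0, 0; 0, -1, 0; 0, 0, 1])
    (u : ℕ → ↥(unitaryGroupOfForm σ J))
    (hu : ∀ m, ((u m : GL (Fin 3) K) : Matrix (Fin 3) (Fin 3) K) = !![ϖ ^ m, y, (ϖ ^ m)⁻¹; 0, 1, -σ y * (ϖ ^ m)⁻¹; 0, 0, (ϖ ^ m)⁻¹])
    {R : Type u} [CommRing R] [IsDomain R] [IsDiscreteValuationRing R] [Finite (ResidueField R)] (ι : R →+* K) (hι : Function.Injective ι)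
    (hιv : ∀ x : K, Valued.v x ≤ 1 ↔ x ∈ Set.range ι) (σR : R →+* R) (hσR : ∀ r, σR (σR r) = r) (hσι : ∀ r, ι (σR r) = σ (ι r))
    {dR : R} (hdRσ : σR dR = -dR) (hdRu : IsUnit dR) (h2R : IsUnit (2 : R)) {ϖR : R} (hϖR : Irreducible ϖR) (hιϖ : ι ϖR = ϖ)
    {t : ↥(unitaryGroupOfForm σ J)} {e θ θ' a b cc : K} (h2e : 2 * e = 1) (hθ : θ = ϖ ^ 1) (hθ' : θ' = (ϖ ^ 1)⁻¹)
    (ha : σ a * a = 1) (hb : σ b * b = 1) (hcc : σ cc * cc = 1)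
    (hte : ((t : GL (Fin 3) K) : Matrix (Fin 3) (Fin 3) K) = !![e * (a + cc), 0, -(e * (a - cc) * θ); 0, b, 0; -(e * (a - cc) * θ'), 0, e * (a + cc)])
    (htH : t ∈ Subgroup.centralizer ({c} : Set ↥(unitaryGroupOfForm σ J)))
    (r : ℕ → ↥(Subgroup.centralizer ({c} : Set ↥(unitaryGroupOfForm σ J))))
    (hr : ∀ i, (((r i : ↥(unitaryGroupOfForm σ J)) : GL (Fin 3) K) : Matrix (Fin 3) (Fin 3) K) = !![(ϖ ^ i)⁻¹, 0, 0; 0, 1, 0; 0, 0, ϖ ^ i])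
    {N Np : ℕ} (hN : Valued.v (a - cc) = Valued.v (ϖ ^ N)) (hNp : Valued.v (a + cc - 2 * b) = Valued.v (ϖ ^ Np))
    {q : ℕ} (hq : Nat.card (ResidueField 𝒪[K]) = q ^ 2) (hqR : Nat.card (ResidueField R) = q ^ 2) (hq1 : 1 < q)
    {a₀ : 𝒪[K]} (ha₀ : IsUnit (((σ.comp 𝒪[K].subtype).codRestrict 𝒪[K] hσO) a₀ - a₀))
    (hfin : {x : ↥(unitaryGroupOfForm σ J) ⧸ unitaryInt σ J | t • x = x}.Finite) :
    (Nat.card {x : ↥(unitaryGroupOfForm σ J) ⧸ unitaryInt σ J | t • x = x} : ℚ) = phiOne q Np N := by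
  have hϖ0 : ϖ ≠ 0 := hd.ϖ_ne_zero
  have he0 : e ≠ 0 := fun h => by rw [h, mul_zero] at h2e; exact zero_ne_one h2e
  have hac : a - cc ≠ 0 := by
    intro h; rw [h, map_zero] at hN; exact (pow_ne_zero _ hϖ0) ((map_eq_zero _).1 hN.symm)
  have hθ'0 : θ' ≠ 0 := by rw [hθ']; exact inv_ne_zero (pow_ne_zero _ hϖ0)
  have hC : -(e * (a - cc) * θ') ≠ 0 := neg_ne_zero.2 (mul_ne_zero (mul_ne_zero he0 hac) hθ'0)
  have hθθ' : θ * θ' = 1 := by rw [hθ, hθ']; exact mul_inv_cancel₀ (pow_ne_zero _ hϖ0)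
  have hBC : -(e * (a - cc) * θ) * θ' = -(e * (a - cc) * θ') * θ := by ring
  have hr' : ∀ i, (((r i : ↥(unitaryGroupOfForm σ J)) : GL (Fin 3) K) : Matrix (Fin 3) (Fin 3) K) = !![ϖ⁻¹ ^ i, 0, 0; 0, 1, 0; 0, 0, ϖ ^ i] :=
    fun i => by rw [hr i, inv_pow]
  refine natCard_fixedPoints_unitaryInt_flickerTorus_eq_phiOne σ hJ hd hσO hy hc u hu h2e hθ hθ' ha hb hcc hte htH
    (fun i => (r i : ↥(unitaryGroupOfForm σ J))) hr' (fun i => (r i).2) hN hNp hq hq1 ha₀ hfin fun m => ?_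
  -- Cor. 9 at level `m`, in the (F2) currency
  have hS := subgroupOf_flickerHK_eq σ c (u m)
  have hfinm : {x : ↥(Subgroup.centralizer ({c} : Set ↥(unitaryGroupOfForm σ J))) ⧸
      (flickerHK σ J c (u m)).subgroupOf (Subgroup.centralizer ({c} : Set ↥(unitaryGroupOfForm σ J))) |
        (⟨t, htH⟩ : ↥(Subgroup.centralizer ({c} : Set ↥(unitaryGroupOfForm σ J)))) • x = x}.Finite := by
    rw [hS]; exact Set.finite_coe_iff.1 ((finite_setOf_nonempty_fixedPoints_flickerU σ hJ hd hy hc u hu htH hfin).2 m)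
  have h9 := natCard_fixedPoints_flickerTorus_eq_finsum σ hJ hd hy m (hu m) ι hι hιv σR hσR hσι hdRσ hdRu h2R hϖR hιϖ hqR hc
    (ε := 1) le_rfl hθ hθθ' htH hte hC hBC r hr hfinm
  rw [hS] at h9
  exact h9

end ThetaOneClosed

end UnitaryGroup

end Literature.NumberTheory.Automorphic
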